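import Summits.CriticalPhenomena.PercolationContinuityZ3.Theorems.Transplant.SkelNegBParamsReachFC
import Summits.CriticalPhenomena.PercolationContinuityZ3.Theorems.Transplant.SkelPhiRootFoot
import HarnessLib

/-!
# N1 params, chain of record `NegB`, part Foot: ANISOTROPIC FINE CONTAINMENT — the per-axis twin of hp-8's `fine_containment` / p3-g9's `abs_fineSkel_le_of_near`:
# planar extents `sα` (axis 0) and `sβ` (axis 1) SEPARATELY give fine extents `k₀, k₁` as soon as `c₀·|A|·(|vβ|·sα + |vα|·sβ) ≤ k₀·D` and
# `c₁·|A|·(|n|·sβ + |h|·sα) ≤ k₁·D` (located stmt-g14 2026-08-21T18:19:31Z: with ONE sup-norm extent `s ≈ 3ℓ_L` the (R6) room `kR ≤ 5r₀ − 2` fails once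
# `ℓ_L ≳ 67·n_L`, while the long parallelogram's true fine footprint is `≲ 4·n_L ≪ 5r₀`), and the fine extents OF RECORD for a planar box `[sα, sβ]` about a centre:
# `NegB.kFoot₀/kFoot₁ … sα sβ` with `hL0_R/hL1_R` (ceilings of the two inequalities at `prF`'s fields)

builds on p205010 (kernel theorem, internal audit signed; external expert review pending) — nothing in this file uses p205010; NOTHING is claimed about
the node `SamePDropOfSkeletonNeg₁` (OPEN).
Status sentence (coordinator 2026-08-20T04:30Z): "θ(p_c) = 0 on ℤ^d, all d ≥ 2 — kernel-verified (Lean 4/Mathlib, standard axioms); internal adversarial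
audit SIGNED 2026-08-20 04:29Z; external expert review pending."
Lane `prim-bschramm-*`, seat `prim-bschramm-stmt` (gen 14); helper file (`--supports stmt-CriticalPhenomena-4575 --as helper`); ledger HOME/prim-bschramm-stmt/NEG-PARAMS.md v0.12.
* §1 **`fine_containment₂`** (any fine skeleton, two planar extents), **`abs_fineSkel_le_of_near₂`** (about the base vertex, offsets `D/2`);
* §2 at the frame record `prF`: **`kFoot₀ sα sβ`, `kFoot₁ sα sβ`** (`:= ⌈c_i·|A|·(…)/D⌉` as floor + 1), **`hL0_R/hL1_R`**, `kFoot_nonneg`, and the packaged reading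
  **`abs_fine_le_of_near₂`** (`|φ′ w i − φ′ t i| ≤ (sα, sβ)_i ⇒ |fine … φ′ w i| ≤ kFoot_i`);
* §3 **`fine_containment_lam₂`**, **`abs_fineSkel_le_of_lam₂`** (bounds on the lattice functionals `v_βΔ₀ − v_αΔ₁`, `nΔ₁ − hΔ₀` instead of per-axis extents — exact
  for sheared regions), **`lam_bounds_of_mem_pgramCyl`** (the long parallelogram: `≤ m + n·L`, `≤ n·L`).
[cite: KozmaNitzan2024, §4 Lemma 10 Step IV; Lemma 12 (pp. 23–25)] [cite: MartineauTassion2017, §4.3]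
-/

noncomputable section

open scoped Classical

namespace Summit.CriticalPhenomena.PercolationContinuityZ3.Theorems.Transplant

/-! ## §1 Anisotropic fine containment -/

namespace Skelφ

open Literature.Probability.LatticeModels TwoAxis.Para

variable {V : Type} {φ : V → Site 2}

/-- **ANISOTROPIC FINE CONTAINMENT**: planar positions within `sα` in coordinate `0` and `sβ` in coordinate `1` have fine positions within `k₀`, `k₁` as soon as
`c₀·|A|·(|vβ|·sα + |vα|·sβ) ≤ k₀·D` and `c₁·|A|·(|n|·sβ + |h|·sα) ≤ k₁·D` (twin of `fine_containment`, which reads one extent for both coordinates).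
[cite: KozmaNitzan2024, §4 Lemma 10 Step IV] -/
theorem fine_containment₂ (t : V) {A n h vα vβ c₀ c₁ s₀ s₁ D sα sβ k₀ k₁ : ℤ} (hD : 0 < D) (hc₀ : 0 ≤ c₀) (hc₁ : 0 ≤ c₁)
    (hL0 : c₀ * (|A| * (|vβ| * sα + |vα| * sβ)) ≤ k₀ * D) (hL1 : c₁ * (|A| * (|n| * sβ + |h| * sα)) ≤ k₁ * D)
    {w w' : V} (h0 : |φ w 0 - φ w' 0| ≤ sα) (h1 : |φ w 1 - φ w' 1| ≤ sβ) :
    |fineSkel φ t A n h vα vβ c₀ c₁ s₀ s₁ D w 0 - fineSkel φ t A n h vα vβ c₀ c₁ s₀ s₁ D w' 0| ≤ k₀ ∧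
      |fineSkel φ t A n h vα vβ c₀ c₁ s₀ s₁ D w 1 - fineSkel φ t A n h vα vβ c₀ c₁ s₀ s₁ D w' 1| ≤ k₁ := by
  have hl0 : |lam0 A vα vβ (relφ φ t w) - lam0 A vα vβ (relφ φ t w')| ≤ |A| * (|vβ| * sα + |vα| * sβ) := by
    have e : lam0 A vα vβ (relφ φ t w) - lam0 A vα vβ (relφ φ t w') = A * (vβ * (φ w 0 - φ w' 0) - vα * (φ w 1 - φ w' 1)) := by
      simp only [TwoAxis.Para.lam0, relφ_apply]; ring
    rw [e, abs_mul]
    refine mul_le_mul_of_nonneg_left ?_ (abs_nonneg A)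
    calc |vβ * (φ w 0 - φ w' 0) - vα * (φ w 1 - φ w' 1)| ≤ |vβ * (φ w 0 - φ w' 0)| + |vα * (φ w 1 - φ w' 1)| := abs_sub _ _
      _ = |vβ| * |φ w 0 - φ w' 0| + |vα| * |φ w 1 - φ w' 1| := by rw [abs_mul, abs_mul]
      _ ≤ |vβ| * sα + |vα| * sβ := by gcongr
  have hl1 : |lam1 A n h (relφ φ t w) - lam1 A n h (relφ φ t w')| ≤ |A| * (|n| * sβ + |h| * sα) := by
    have e : lam1 A n h (relφ φ t w) - lam1 A n h (relφ φ t w') = A * (n * (φ w 1 - φ w' 1) - h * (φ w 0 - φ w' 0)) := by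
      simp only [TwoAxis.Para.lam1, TwoAxis.Para.bp, relφ_apply]; ring
    rw [e, abs_mul]
    refine mul_le_mul_of_nonneg_left ?_ (abs_nonneg A)
    calc |n * (φ w 1 - φ w' 1) - h * (φ w 0 - φ w' 0)| ≤ |n * (φ w 1 - φ w' 1)| + |h * (φ w 0 - φ w' 0)| := abs_sub _ _
      _ = |n| * |φ w 1 - φ w' 1| + |h| * |φ w 0 - φ w' 0| := by rw [abs_mul, abs_mul]
      _ ≤ |n| * sβ + |h| * sα := by gcongr
  rw [fineSkel_apply_zero, fineSkel_apply_zero, fineSkel_apply_one, fineSkel_apply_one]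
  constructor
  · refine TwoAxis.Para.abs_coarse_sub_le_of_mul hD ?_
    rw [← mul_sub, abs_mul, abs_of_nonneg hc₀]
    exact (mul_le_mul_of_nonneg_left hl0 hc₀).trans hL0
  · refine TwoAxis.Para.abs_coarse_sub_le_of_mul hD ?_
    rw [← mul_sub, abs_mul, abs_of_nonneg hc₁]
    exact (mul_le_mul_of_nonneg_left hl1 hc₁).trans hL1

/-- **About the base vertex** (offsets `D/2`, `fineSkel t = 0`): `|φ w 0 − φ t 0| ≤ sα`, `|φ w 1 − φ t 1| ≤ sβ` ⇒ `|fine w 0| ≤ k₀`, `|fine w 1| ≤ k₁` (twin of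
`abs_fineSkel_le_of_near`). [folklore] -/
theorem abs_fineSkel_le_of_near₂ (t : V) {A n h vα vβ c₀ c₁ D sα sβ k₀ k₁ : ℤ} (hD : 0 < D) (hc₀ : 0 ≤ c₀) (hc₁ : 0 ≤ c₁)
    (hL0 : c₀ * (|A| * (|vβ| * sα + |vα| * sβ)) ≤ k₀ * D) (hL1 : c₁ * (|A| * (|n| * sβ + |h| * sα)) ≤ k₁ * D)
    {w : V} (h0 : |φ w 0 - φ t 0| ≤ sα) (h1 : |φ w 1 - φ t 1| ≤ sβ) :
    |fineSkel φ t A n h vα vβ c₀ c₁ (D / 2) (D / 2) D w 0| ≤ k₀ ∧ |fineSkel φ t A n h vα vβ c₀ c₁ (D / 2) (D / 2) D w 1| ≤ k₁ := by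
  have hfc := fine_containment₂ (φ := φ) t (s₀ := D / 2) (s₁ := D / 2) hD hc₀ hc₁ hL0 hL1 h0 h1
  have ht := fineSkel_self (φ := φ) t A n h vα vβ c₀ c₁ hD
  rw [ht] at hfc
  simpa using hfc

end Skelφ

/-! ## §2 The fine extents of record for a planar box at the frame record -/

namespace PlanarSkeletonNeg

namespace NegB

open Literature.Probability.Percolation Literature.Probability.LatticeModels SimpleGraph
open SkelConc (Consts)
open Skelφ.StepI (DataN)
open TwoAxis.Para (modulus)
open Neg

section Values

variable (κ : Consts) {V : Type} [DecidableEq V] [Countable V] {G : SimpleGraph V} [G.LocallyFinite] (Φ : PlanarSkeletonNeg G) (t : V)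
  (p : unitInterval) (D : DataN V) (g f : ℕ) (sα sβ : ℤ)

/-- **The fine extent on axis `0`** of the planar box `[±sα] × [±sβ]`: `kFoot₀ := ⌈c₀·|A|·(|vβ|·sα + |vα|·sβ)/D⌉` (floor + 1). [this work] -/
def kFoot₀ : ℤ := (prF κ Φ t p D g f).c₀ * (|(prF κ Φ t p D g f).A| * (|(prF κ Φ t p D g f).vβ| * sα + |(prF κ Φ t p D g f).vα| * sβ)) / (prF κ Φ t p D g f).D + 1

/-- **The fine extent on axis `1`**: `kFoot₁ := ⌈c₁·|A|·(|n|·sβ + |h|·sα)/D⌉` (floor + 1). [this work] -/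
def kFoot₁ : ℤ := (prF κ Φ t p D g f).c₁ * (|(prF κ Φ t p D g f).A| * (|(prF κ Φ t p D g f).n| * sβ + |(prF κ Φ t p D g f).h| * sα)) / (prF κ Φ t p D g f).D + 1

/-- **`hL0`** at `k₀ := kFoot₀`. [folklore] -/
theorem hL0_R (hN : EqNumL κ Φ t p D g f) :
    (prF κ Φ t p D g f).c₀ * (|(prF κ Φ t p D g f).A| * (|(prF κ Φ t p D g f).vβ| * sα + |(prF κ Φ t p D g f).vα| * sβ)) ≤ kFoot₀ κ Φ t p D g f sα sβ * (prF κ Φ t p D g f).D := by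
  have hD := (prF_pos κ Φ t p D g f hN).2.2.2.2.2
  unfold kFoot₀; rw [mul_comm _ (prF κ Φ t p D g f).D]; exact ceil_mul_le hD

/-- **`hL1`** at `k₁ := kFoot₁`. [folklore] -/
theorem hL1_R (hN : EqNumL κ Φ t p D g f) :
    (prF κ Φ t p D g f).c₁ * (|(prF κ Φ t p D g f).A| * (|(prF κ Φ t p D g f).n| * sβ + |(prF κ Φ t p D g f).h| * sα)) ≤ kFoot₁ κ Φ t p D g f sα sβ * (prF κ Φ t p D g f).D := by
  have hD := (prF_pos κ Φ t p D g f hN).2.2.2.2.2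
  unfold kFoot₁; rw [mul_comm _ (prF κ Φ t p D g f).D]; exact ceil_mul_le hD

/-- `0 ≤ kFoot₀`, `0 ≤ kFoot₁` for nonnegative extents (under the numeric long clause). [folklore] -/
theorem kFoot_nonneg (hN : EqNumL κ Φ t p D g f) (hα : 0 ≤ sα) (hβ : 0 ≤ sβ) : 0 ≤ kFoot₀ κ Φ t p D g f sα sβ ∧ 0 ≤ kFoot₁ κ Φ t p D g f sα sβ := by
  obtain ⟨-, -, -, hc₀, hc₁, hD⟩ := prF_pos κ Φ t p D g f hN
  constructor
  · unfold kFoot₀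
    have : 0 ≤ (prF κ Φ t p D g f).c₀ * (|(prF κ Φ t p D g f).A| * (|(prF κ Φ t p D g f).vβ| * sα + |(prF κ Φ t p D g f).vα| * sβ)) / (prF κ Φ t p D g f).D :=
      Int.ediv_nonneg (by positivity) hD.le
    linarith
  · unfold kFoot₁
    have : 0 ≤ (prF κ Φ t p D g f).c₁ * (|(prF κ Φ t p D g f).A| * (|(prF κ Φ t p D g f).n| * sβ + |(prF κ Φ t p D g f).h| * sα)) / (prF κ Φ t p D g f).D :=
      Int.ediv_nonneg (by positivity) hD.le
    linarith

/-- **THE PACKAGED READING** (map slot `φ′`): a vertex within planar extents `(sα, sβ)` of the base vertex `t` has fine position within `(kFoot₀, kFoot₁)`. [folklore] -/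
theorem abs_fine_le_of_near₂ (hN : EqNumL κ Φ t p D g f) {φ' : V → Site 2} {w : V} (h0 : |φ' w 0 - φ' t 0| ≤ sα) (h1 : |φ' w 1 - φ' t 1| ≤ sβ) :
    |fine κ Φ t p D g f φ' w 0| ≤ kFoot₀ κ Φ t p D g f sα sβ ∧ |fine κ Φ t p D g f φ' w 1| ≤ kFoot₁ κ Φ t p D g f sα sβ := by
  obtain ⟨-, -, -, hc₀, hc₁, hD⟩ := prF_pos κ Φ t p D g f hN
  have hψ : fine κ Φ t p D g f φ' = (prF κ Φ t p D g f).ψ φ' t := (prF_ψ κ Φ t p D g f φ').symm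
  have h := Skelφ.fine_containment₂ (φ := φ') t (s₀ := (prF κ Φ t p D g f).D / 2) (s₁ := (prF κ Φ t p D g f).D / 2) hD hc₀.le hc₁.le
    (hL0_R κ Φ t p D g f sα sβ hN) (hL1_R κ Φ t p D g f sα sβ hN) h0 h1
  have h0' := fine_base_at κ Φ t p D g f φ' hN
  rw [hψ] at h0' ⊢
  unfold Skelφ.FinePrm.ψ at h h0' ⊢
  rw [h0'] at h
  simpa using h

end Values

end NegB

end PlanarSkeletonNeg


/-! ## §3 Fine containment from the LATTICE FUNCTIONALS (located stmt-g14 2026-08-21T19:4xZ: per-axis extents still over-read a sheared region — steep long pair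
`|h_L| ≈ 10 n_L` with `n_L ≫ ℓ_L`; the functionals `v_β·Δ₀ − v_α·Δ₁` and `n·Δ₁ − h·Δ₀` are read directly) -/

namespace Skelφ

open Literature.Probability.LatticeModels TwoAxis.Para

variable {V : Type} {φ : V → Site 2}

/-- **Fine containment from bounds on the two lattice functionals** (any fine skeleton, any offsets): if
`|v_β(φw₀−φw′₀) − v_α(φw₁−φw′₁)| ≤ Λ₀`, `|n(φw₁−φw′₁) − h(φw₀−φw′₀)| ≤ Λ₁`, `c₀·|A|·Λ₀ ≤ k₀·D`, `c₁·|A|·Λ₁ ≤ k₁·D`, the two fine images differ by at most `(k₀, k₁)`.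
[cite: KozmaNitzan2024, §4 Lemma 10 Step IV] -/
theorem fine_containment_lam₂ (t : V) {A n h vα vβ c₀ c₁ s₀ s₁ D Λ₀ Λ₁ k₀ k₁ : ℤ} (hD : 0 < D) (hc₀ : 0 ≤ c₀) (hc₁ : 0 ≤ c₁)
    (hL0 : c₀ * (|A| * Λ₀) ≤ k₀ * D) (hL1 : c₁ * (|A| * Λ₁) ≤ k₁ * D)
    {w w' : V} (h0 : |vβ * (φ w 0 - φ w' 0) - vα * (φ w 1 - φ w' 1)| ≤ Λ₀) (h1 : |n * (φ w 1 - φ w' 1) - h * (φ w 0 - φ w' 0)| ≤ Λ₁) :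
    |fineSkel φ t A n h vα vβ c₀ c₁ s₀ s₁ D w 0 - fineSkel φ t A n h vα vβ c₀ c₁ s₀ s₁ D w' 0| ≤ k₀ ∧
      |fineSkel φ t A n h vα vβ c₀ c₁ s₀ s₁ D w 1 - fineSkel φ t A n h vα vβ c₀ c₁ s₀ s₁ D w' 1| ≤ k₁ := by
  have hl0 : |lam0 A vα vβ (relφ φ t w) - lam0 A vα vβ (relφ φ t w')| ≤ |A| * Λ₀ := by
    have e : lam0 A vα vβ (relφ φ t w) - lam0 A vα vβ (relφ φ t w') = A * (vβ * (φ w 0 - φ w' 0) - vα * (φ w 1 - φ w' 1)) := by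
      simp only [TwoAxis.Para.lam0, relφ_apply]; ring
    rw [e, abs_mul]
    exact mul_le_mul_of_nonneg_left h0 (abs_nonneg A)
  have hl1 : |lam1 A n h (relφ φ t w) - lam1 A n h (relφ φ t w')| ≤ |A| * Λ₁ := by
    have e : lam1 A n h (relφ φ t w) - lam1 A n h (relφ φ t w') = A * (n * (φ w 1 - φ w' 1) - h * (φ w 0 - φ w' 0)) := by
      simp only [TwoAxis.Para.lam1, TwoAxis.Para.bp, relφ_apply]; ring
    rw [e, abs_mul]
    exact mul_le_mul_of_nonneg_left h1 (abs_nonneg A)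
  rw [fineSkel_apply_zero, fineSkel_apply_zero, fineSkel_apply_one, fineSkel_apply_one]
  constructor
  · refine TwoAxis.Para.abs_coarse_sub_le_of_mul hD ?_
    rw [← mul_sub, abs_mul, abs_of_nonneg hc₀]
    exact (mul_le_mul_of_nonneg_left hl0 hc₀).trans hL0
  · refine TwoAxis.Para.abs_coarse_sub_le_of_mul hD ?_
    rw [← mul_sub, abs_mul, abs_of_nonneg hc₁]
    exact (mul_le_mul_of_nonneg_left hl1 hc₁).trans hL1

/-- **About the base vertex** (offsets `D/2`, `fineSkel t = 0`): functional bounds `Λ₀, Λ₁` of `φ w − φ t` give `|fine w 0| ≤ k₀`, `|fine w 1| ≤ k₁` — the lemma the root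
residue's near-root block should read (`hΛR` over the bridge region / hop prism instead of per-axis `hsR`). [folklore] -/
theorem abs_fineSkel_le_of_lam₂ (t : V) {A n h vα vβ c₀ c₁ D Λ₀ Λ₁ k₀ k₁ : ℤ} (hD : 0 < D) (hc₀ : 0 ≤ c₀) (hc₁ : 0 ≤ c₁)
    (hL0 : c₀ * (|A| * Λ₀) ≤ k₀ * D) (hL1 : c₁ * (|A| * Λ₁) ≤ k₁ * D)
    {w : V} (h0 : |vβ * (φ w 0 - φ t 0) - vα * (φ w 1 - φ t 1)| ≤ Λ₀) (h1 : |n * (φ w 1 - φ t 1) - h * (φ w 0 - φ t 0)| ≤ Λ₁) :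
    |fineSkel φ t A n h vα vβ c₀ c₁ (D / 2) (D / 2) D w 0| ≤ k₀ ∧ |fineSkel φ t A n h vα vβ c₀ c₁ (D / 2) (D / 2) D w 1| ≤ k₁ := by
  have hfc := fine_containment_lam₂ (φ := φ) t (s₀ := D / 2) (s₁ := D / 2) hD hc₀ hc₁ hL0 hL1 h0 h1
  have ht := fineSkel_self (φ := φ) t A n h vα vβ c₀ c₁ hD
  rw [ht] at hfc
  simpa using hfc

/-- **The long parallelogram read by the functionals**: `|Δ₀| ≤ n`, `|nΔ₁ − hΔ₀| ≤ n·L` (`w ∈ pgramCyl φ t n h L`), `|v_α| ≤ n`, `m = n·v_β − h·v_α` ⇒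
`|v_βΔ₀ − v_αΔ₁| ≤ m + n·L` (from `n(v_βΔ₀ − v_αΔ₁) = mΔ₀ − v_α(nΔ₁ − hΔ₀)`) and `|nΔ₁ − hΔ₀| ≤ n·L`. [folklore] -/
theorem lam_bounds_of_mem_pgramCyl {t : V} {n : ℕ} (hn : 1 ≤ n) {h vα vβ : ℤ} (hv : |vα| ≤ n) (hm : 0 ≤ modulus n h vα vβ) {L : ℕ} {w : V}
    (hw : w ∈ pgramCyl φ t n h L) :
    |vβ * (φ w 0 - φ t 0) - vα * (φ w 1 - φ t 1)| ≤ modulus n h vα vβ + n * L ∧ |(n : ℤ) * (φ w 1 - φ t 1) - h * (φ w 0 - φ t 0)| ≤ (n : ℤ) * L := by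
  rw [mem_pgramCyl, relCoord_apply, shearCoord_apply] at hw
  obtain ⟨h0, h1⟩ := hw
  refine ⟨?_, h1⟩
  have hn0 : (0 : ℤ) < n := by exact_mod_cast hn
  have e : (n : ℤ) * (vβ * (φ w 0 - φ t 0) - vα * (φ w 1 - φ t 1)) =
      modulus n h vα vβ * (φ w 0 - φ t 0) - vα * ((n : ℤ) * (φ w 1 - φ t 1) - h * (φ w 0 - φ t 0)) := by
    unfold modulus; ring
  have h2 : |(n : ℤ) * (vβ * (φ w 0 - φ t 0) - vα * (φ w 1 - φ t 1))| ≤ modulus n h vα vβ * n + (n : ℤ) * ((n : ℤ) * L) := by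
    rw [e]
    calc |modulus n h vα vβ * (φ w 0 - φ t 0) - vα * ((n : ℤ) * (φ w 1 - φ t 1) - h * (φ w 0 - φ t 0))|
        ≤ |modulus n h vα vβ * (φ w 0 - φ t 0)| + |vα * ((n : ℤ) * (φ w 1 - φ t 1) - h * (φ w 0 - φ t 0))| := abs_sub _ _
      _ = modulus n h vα vβ * |φ w 0 - φ t 0| + |vα| * |(n : ℤ) * (φ w 1 - φ t 1) - h * (φ w 0 - φ t 0)| := by
          rw [abs_mul, abs_mul, abs_of_nonneg hm]
      _ ≤ modulus n h vα vβ * n + (n : ℤ) * ((n : ℤ) * L) := add_le_add (mul_le_mul_of_nonneg_left h0 hm) (mul_le_mul hv h1 (abs_nonneg _) hn0.le)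
  rw [abs_mul, Nat.abs_cast] at h2
  have h3 : (n : ℤ) * |vβ * (φ w 0 - φ t 0) - vα * (φ w 1 - φ t 1)| ≤ (n : ℤ) * (modulus n h vα vβ + n * L) := by linarith [h2]
  exact le_of_mul_le_mul_left h3 hn0

end Skelφ

end Summit.CriticalPhenomena.PercolationContinuityZ3.Theorems.Transplant

end
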